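import Mathlib
import HarnessLib
import Summits.HubbardSuperconductivity.HubbardSuperconductivity.Theorems.KLProgrammeKLRegimeEngineV8PairTransferExport7

/-!
# Route `KLProgramme` — ENGINE child gen 8 (stmt-HubbardSuperconductivity-20437 `KLRegimeEngineV17F2`), skeleton-v2 class #5 / stub (c) under «Export7» (p597496, ruling (R103)
# «REL-DIRECT»): the inherited relative bar's NUMERIC SHARES of the (E2-F2)ₙ slots at the deferred constant `klCT7` and the thermal package `klEngGeoTh`, TOKEN-FREE in the
# engine package (cell gate-hubbard-kl, seat hubbard-kl-p1 g14)

WHY.  Under the direct door (`pairLadderStepAtV17F2_of_relFamilyK5_klCT7`, Export7 §4) the (c) closer fits the inherited bar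
`Tb := transferBarRelIdx L klEngGeoTh P (klCT7 …) β U (n−1) (n−1)` into the frozen (E2-F2)ₙ line slot by slot (`transferBarRelIdx_pinned_le_slots`, p596929).  This file
turns the symbolic shares into NUMERALS for any engine package of the record's shape — `G = G₀.addShellLog 2⁵²` with `0 ≤ G₀.phGain` (klEngGeo9/10/11: `klEngGeo10_eq_addShellLog`
and its successors) and `2⁸⁰ ≤ G.CF` (`two_pow_le_klEngGeo5_CF` and the `CF`-monotone raises) — so the closer's arithmetic reads no `Classical.choose`:
**`transferBarRelIdx_klCT7_le_slots`**: `Tb(n, n) ≤ 2⁻¹⁵·(KlamU)²·(G.phGain (n+1) ρ_d + G.phGain (n+1) ρ_x) + 2·klCT7·15367·(KlamU)²/L + 4·klCT7·15367·(Klam|U|)³·2^{−(n+1)} +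
2⁻⁵·thermalBar G (n+1)` (ph share `8·klCT7·15367/2⁵² ≤ 2⁻¹⁵` = `klCT7_ph_share_le`; thermal `2·klCT7·15367·thermalBar klEngGeoTh = (2·klCT7·15367·2⁴⁰/G.CF)·thermalBar G ≤ (2⁷⁵/2⁸⁰)·thermalBar G`
= `klCT7_thermal_weight_le`), plus the `klRelGain`-form for the FT convolutions (`transferBarRelIdx_klCT7_le_succ_shapes`, prefactor `2·klCT7·15367 ≤ 2²¹·15367`) and the
uniform (label-free) part `transferBarRelIdx_klCT7_uniform_le`.  Real arithmetic over landed lemmas; nothing about the model is asserted; nothing asserts superconductivity.  0 kit.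
-/

noncomputable section

namespace Summit.HubbardSuperconductivity.HubbardSuperconductivity.Theorems.EngineV8

set_option linter.dupNamespace false -- summit = problem name (single-conjunct summit), D-0017

open Real Finset Literature.MathematicalPhysics.QuantumLattice Literature.Probability.LatticeModels
open Summit.HubbardSuperconductivity.HubbardSuperconductivity.Theorems.KLProgrammeLegKernels
open Summit.HubbardSuperconductivity.HubbardSuperconductivity.Theorems.KLRegimeSplit

variable {L : ℕ}

/-- **The thermal content at the package `klEngGeoTh` against an engine package with `2⁸⁰ ≤ G.CF`**:
`2·klCT7·15367·thermalBar klEngGeoTh P U β n ≤ 2⁻⁵·thermalBar G P U β n`. -/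
theorem klCT7_thermal_content_le {G : GeoConsts} (hCF : (2 : ℝ) ^ 80 ≤ G.CF) (P : SplitConsts) (R : RenConsts) (Q₀ : EngConsts) (G' : GeoConsts) (U β : ℝ) (n : ℕ) :
    2 * klCT7 P R Q₀ G' klEngGeoTh * 15367 * thermalBar klEngGeoTh P U β n ≤ (2 : ℝ)⁻¹ ^ 5 * thermalBar G P U β n := by
  have hCF0 : 0 < G.CF := lt_of_lt_of_le (by positivity) hCF
  have hw := klCT7_thermal_weight_le P R Q₀ G'
  -- `thermalBar Gth = Gth.CF·X`, `thermalBar G = G.CF·X` with the common nonnegative factor `X = (KlamU)²·4^{-(n_β−n)}`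
  have hX : 0 ≤ (P.Klam * U) ^ 2 * ((4 : ℝ) ^ (nScales β - n))⁻¹ := by positivity
  unfold thermalBar
  rw [klEngGeoTh_CF] at hw ⊢
  -- goal: 2·c·15367·(2^40·K²·q) ≤ 2⁻⁵·(G.CF·K²·q)
  have h1 : 2 * klCT7 P R Q₀ G' klEngGeoTh * 15367 * ((2 : ℝ) ^ 40 * (P.Klam * U) ^ 2 * ((4 : ℝ) ^ (nScales β - n))⁻¹) =
      (2 * klCT7 P R Q₀ G' klEngGeoTh * 15367 * 2 ^ 40) * ((P.Klam * U) ^ 2 * ((4 : ℝ) ^ (nScales β - n))⁻¹) := by ring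
  have h2 : (2 : ℝ)⁻¹ ^ 5 * (G.CF * (P.Klam * U) ^ 2 * ((4 : ℝ) ^ (nScales β - n))⁻¹) = ((2 : ℝ)⁻¹ ^ 5 * G.CF) * ((P.Klam * U) ^ 2 * ((4 : ℝ) ^ (nScales β - n))⁻¹) := by
    ring
  rw [h1, h2]
  refine mul_le_mul_of_nonneg_right ?_ hX
  calc 2 * klCT7 P R Q₀ G' klEngGeoTh * 15367 * 2 ^ 40 ≤ 2 ^ 75 := hw
    _ = (2 : ℝ)⁻¹ ^ 5 * 2 ^ 80 := by norm_num
    _ ≤ (2 : ℝ)⁻¹ ^ 5 * G.CF := by gcongr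

/-- **THE NUMERIC SHARES of the inherited relative bar at `(klCT7, klEngGeoTh)`** against an engine package `G = G₀.addShellLog 2⁵²` (`0 ≤ G₀.phGain`, `2⁸⁰ ≤ G.CF`; `0 ≤ P.Klam`):
`transferBarRelIdx L klEngGeoTh P (klCT7 …) β U n n Qm k k′ ≤ 2⁻¹⁵·(KlamU)²·(G.phGain (n+1) ρ_d + G.phGain (n+1) ρ_x) + 2·klCT7·15367·(KlamU)²/L + 4·klCT7·15367·(Klam|U|)³·2^{−(n+1)} +
2⁻⁵·thermalBar G (n+1)` — the (c) closer reads it at scale `n+1` for the history pair at `n` (the `1/L` and cubic terms ride `Q.CL`/`Q.CR` or the ph floor `2⁵²·2^{−(n+1)}`). -/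
theorem transferBarRelIdx_klCT7_le_slots {G₀ G : GeoConsts} (hG : G = G₀.addShellLog (2 ^ 52)) (hph : ∀ n ρ, 0 ≤ G₀.phGain n ρ) (hCF : (2 : ℝ) ^ 80 ≤ G.CF)
    {P : SplitConsts} (hKl : 0 ≤ P.Klam) (R : RenConsts) (Q₀ : EngConsts) (G' : GeoConsts) (β U : ℝ) (n : ℕ) (Qm k k' : TorusSite 2 L) :
    transferBarRelIdx L klEngGeoTh P (klCT7 P R Q₀ G' klEngGeoTh) β U n n Qm k k' ≤
      (2 : ℝ)⁻¹ ^ 15 * ((P.Klam * U) ^ 2 * (G.phGain (n + 1) (klTorusNorm L (k - k')) + G.phGain (n + 1) (klTorusNorm L (k + k' - Qm)))) +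
        2 * klCT7 P R Q₀ G' klEngGeoTh * 15367 * ((P.Klam * U) ^ 2 * ((L : ℝ))⁻¹) +
        4 * klCT7 P R Q₀ G' klEngGeoTh * 15367 * ((P.Klam * |U|) ^ 3 * ((2 : ℝ) ^ (n + 1))⁻¹) +
        (2 : ℝ)⁻¹ ^ 5 * thermalBar G P U β (n + 1) := by
  have hr0 := klCT7_nonneg P R Q₀ G' klEngGeoTh
  have h := transferBarRelIdx_pinned_le_slots (L := L) (G₀ := G₀) (Gth := klEngGeoTh) hph klEngGeoTh_CF_nonneg (C := 2 ^ 52) (by positivity) hKl hr0 β U n Qm k k'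
  rw [← hG] at h
  refine h.trans ?_
  have hph' : ∀ m ρ, 0 ≤ G.phGain m ρ := by
    intro m ρ
    rw [hG, GeoConsts.addShellLog_phGain]
    have := hph m ρ
    have := klRelGain_nonneg m (le_max_right ρ 0)
    positivity
  have hS : 0 ≤ (P.Klam * U) ^ 2 * (G.phGain (n + 1) (klTorusNorm L (k - k')) + G.phGain (n + 1) (klTorusNorm L (k + k' - Qm))) := by
    have := hph' (n + 1) (klTorusNorm L (k - k'))
    have := hph' (n + 1) (klTorusNorm L (k + k' - Qm))
    positivity
  have hshare := klCT7_ph_share_le P R Q₀ G' klEngGeoTh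
  have hth := klCT7_thermal_content_le hCF P R Q₀ G' U β (n + 1)
  have h1 : 8 * klCT7 P R Q₀ G' klEngGeoTh * 15367 / 2 ^ 52 *
        ((P.Klam * U) ^ 2 * (G.phGain (n + 1) (klTorusNorm L (k - k')) + G.phGain (n + 1) (klTorusNorm L (k + k' - Qm)))) ≤
      (2 : ℝ)⁻¹ ^ 15 * ((P.Klam * U) ^ 2 * (G.phGain (n + 1) (klTorusNorm L (k - k')) + G.phGain (n + 1) (klTorusNorm L (k + k' - Qm)))) :=
    mul_le_mul_of_nonneg_right hshare hS
  linarith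

/-- **The `klRelGain`-form for the FT convolutions** (same hypotheses as `transferBarRelIdx_pinned_le_succ_shapes`, at `(klCT7, klEngGeoTh)`, prefactor made numeric:
`2·klCT7·15367 ≤ 2²¹·15367`): `Tb(n, n) ≤ 2²¹·15367·{(KlamU)²·[4(klRelGain (n+1) ρ_d + 2^{−(n+1)}) + 4(klRelGain (n+1) ρ_x + 2^{−(n+1)}) + 1/L] + 2(Klam|U|)³2^{−(n+1)} +
thermalBar klEngGeoTh (n+1)}` — the form `klam_relGain_angular_le` (p593991) consumes against a windowed-mass weight. -/
theorem transferBarRelIdx_klCT7_le_succ_shapes {P : SplitConsts} (hKl : 0 ≤ P.Klam) (R : RenConsts) (Q₀ : EngConsts) (G' : GeoConsts) (β U : ℝ) (n : ℕ)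
    (Qm k k' : TorusSite 2 L) :
    transferBarRelIdx L klEngGeoTh P (klCT7 P R Q₀ G' klEngGeoTh) β U n n Qm k k' ≤
      2 ^ 21 * 15367 * ((P.Klam * U) ^ 2 * (4 * (klRelGain (n + 1) (klTorusNorm L (k - k')) + ((2 : ℝ) ^ (n + 1))⁻¹) +
          4 * (klRelGain (n + 1) (klTorusNorm L (k + k' - Qm)) + ((2 : ℝ) ^ (n + 1))⁻¹) + ((L : ℝ))⁻¹) +
        2 * ((P.Klam * |U|) ^ 3 * ((2 : ℝ) ^ (n + 1))⁻¹) + thermalBar klEngGeoTh P U β (n + 1)) := by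
  have hr0 := klCT7_nonneg P R Q₀ G' klEngGeoTh
  have hcap := klCT7_le_klCTcap7 P R Q₀ G' klEngGeoTh
  refine (transferBarRelIdx_pinned_le_succ_shapes (L := L) klEngGeoTh_CF_nonneg hKl hr0 β U n Qm k k').trans ?_
  have hρd : 0 ≤ klTorusNorm L (k - k') := by unfold klTorusNorm; exact torusSupNorm_nonneg _
  have hρx : 0 ≤ klTorusNorm L (k + k' - Qm) := by unfold klTorusNorm; exact torusSupNorm_nonneg _
  have hB : 0 ≤ (P.Klam * U) ^ 2 * (4 * (klRelGain (n + 1) (klTorusNorm L (k - k')) + ((2 : ℝ) ^ (n + 1))⁻¹) +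
        4 * (klRelGain (n + 1) (klTorusNorm L (k + k' - Qm)) + ((2 : ℝ) ^ (n + 1))⁻¹) + ((L : ℝ))⁻¹) +
      2 * ((P.Klam * |U|) ^ 3 * ((2 : ℝ) ^ (n + 1))⁻¹) + thermalBar klEngGeoTh P U β (n + 1) := by
    have := klRelGain_nonneg (n + 1) hρd
    have := klRelGain_nonneg (n + 1) hρx
    have := thermalBar_nonneg' klEngGeoTh_CF_nonneg P U β (n + 1)
    have : 0 ≤ P.Klam * |U| := mul_nonneg hKl (abs_nonneg U)
    positivity
  refine mul_le_mul_of_nonneg_right ?_ hB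
  have : klCTcap7 = 2 ^ 20 := klCTcap7_eq
  nlinarith

/-- **The UNIFORM (label-free) part of the inherited bar** — what the FT convolutions of the door multiply by `Σ|w₁|`: at `(klCT7, klEngGeoTh)`,
`Tb(n, n) ≤ 2²¹·15367·(KlamU)²·4·(klRelGain (n+1) ρ_d + klRelGain (n+1) ρ_x) + U₀(n+1)` with the label-free
`U₀(n+1) := 2²¹·15367·{(KlamU)²·(8·2^{−(n+1)} + 1/L) + 2(Klam|U|)³2^{−(n+1)} + thermalBar klEngGeoTh (n+1)}`. -/
theorem transferBarRelIdx_klCT7_uniform_le {P : SplitConsts} (hKl : 0 ≤ P.Klam) (R : RenConsts) (Q₀ : EngConsts) (G' : GeoConsts) (β U : ℝ) (n : ℕ)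
    (Qm k k' : TorusSite 2 L) :
    transferBarRelIdx L klEngGeoTh P (klCT7 P R Q₀ G' klEngGeoTh) β U n n Qm k k' ≤
      2 ^ 21 * 15367 * ((P.Klam * U) ^ 2 * (4 * (klRelGain (n + 1) (klTorusNorm L (k - k')) + klRelGain (n + 1) (klTorusNorm L (k + k' - Qm))))) +
        2 ^ 21 * 15367 * ((P.Klam * U) ^ 2 * (8 * ((2 : ℝ) ^ (n + 1))⁻¹ + ((L : ℝ))⁻¹) + 2 * ((P.Klam * |U|) ^ 3 * ((2 : ℝ) ^ (n + 1))⁻¹) +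
          thermalBar klEngGeoTh P U β (n + 1)) := by
  refine (transferBarRelIdx_klCT7_le_succ_shapes (L := L) hKl R Q₀ G' β U n Qm k k').trans (le_of_eq ?_)
  ring

/-! ## §2 (append, p1 g14) The UNIFORM size of the inherited bar — the `r′` of the door's smallness row `(3/2·m + r′)·Σ|w₁| ≤ 1/3` -/

/-- **The relative gain profile is uniformly bounded**: `klRelGain n ρ ≤ 7/3` for every `n` and every `ρ ≥ 0` (the shell count `kₙ(ρ)` is large only where the frozen
factor `Λₙ/ρ` is small: `klRelGain ≤ min(ρ/Λₙ, Λₙ/ρ) + Σ_{j ≤ n, Λ_j ≤ ρ}(Λ_j/ρ)(1/4)^{n−j} ≤ 1 + 4/3`, `klRelGain_le_min_add_sum`). -/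
theorem klRelGain_le_uniform (n : ℕ) {ρ : ℝ} (hρ : 0 ≤ ρ) : klRelGain n ρ ≤ 7 / 3 := by
  rcases hρ.eq_or_lt with h0 | hρ0
  · subst h0; rw [klRelGain_zero]; norm_num
  refine (klRelGain_le_min_add_sum n hρ0).trans ?_
  have h1 : min (ρ / klScale klE0 n) (klScale klE0 n / ρ) ≤ 1 := min_div_div_le_one (klth_klScale_pos n)
  have h2 : ∑ j ∈ (range (n + 1)).filter (fun j => klScale klE0 j ≤ ρ), klScale klE0 j / ρ * ((1 : ℝ) / 4) ^ (n - j) ≤ 4 / 3 := by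
    calc ∑ j ∈ (range (n + 1)).filter (fun j => klScale klE0 j ≤ ρ), klScale klE0 j / ρ * ((1 : ℝ) / 4) ^ (n - j)
        ≤ ∑ j ∈ (range (n + 1)).filter (fun j => klScale klE0 j ≤ ρ), ((1 : ℝ) / 4) ^ (n - j) := by
          refine sum_le_sum fun j hj => ?_
          have hjρ : klScale klE0 j ≤ ρ := (mem_filter.mp hj).2
          have hq : 0 ≤ ((1 : ℝ) / 4) ^ (n - j) := by positivity
          have hle : klScale klE0 j / ρ ≤ 1 := (div_le_one hρ0).mpr hjρ
          nlinarith
      _ ≤ ∑ i ∈ ((range (n + 1)).filter (fun j => klScale klE0 j ≤ ρ)).image (fun j => n - j), ((1 : ℝ) / 4) ^ i := by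
          rw [sum_image']
          intro j hj
          -- the fibre of `n - j` inside `range (n+1)` is `{j}`
          have hjn : j ≤ n := by have := (mem_filter.mp hj).1; simpa [mem_range, Nat.lt_succ_iff] using this
          rw [show (((range (n + 1)).filter (fun j => klScale klE0 j ≤ ρ)).filter fun c => n - c = n - j) = {j} from ?_]
          · rw [sum_singleton]
          · ext c
            simp only [mem_filter, mem_range, Nat.lt_succ_iff, mem_singleton]
            constructor
            · rintro ⟨⟨hc, -⟩, hcj⟩; omega
            · rintro rfl; exact ⟨⟨hjn, (mem_filter.mp hj).2⟩, rfl⟩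
      _ ≤ 4 / 3 := klsl_sum_quarter_pow_le _
  linarith

/-- `thermalBar klEngGeoTh P U β n ≤ 2⁴⁰·(KlamU)²` (`4^{−(n_β−n)} ≤ 1`). -/
theorem thermalBar_klEngGeoTh_le (P : SplitConsts) (U β : ℝ) (n : ℕ) : thermalBar klEngGeoTh P U β n ≤ 2 ^ 40 * (P.Klam * U) ^ 2 := by
  unfold thermalBar
  rw [klEngGeoTh_CF]
  have h4 : ((4 : ℝ) ^ (nScales β - n))⁻¹ ≤ 1 := inv_le_one_of_one_le₀ (one_le_pow₀ (by norm_num))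
  have hU2 : 0 ≤ (P.Klam * U) ^ 2 := by positivity
  nlinarith [mul_nonneg hU2 (sub_nonneg.mpr h4)]

/-- **THE UNIFORM NUMERAL for `r′`**: at `(klCT7, klEngGeoTh)`, for `0 ≤ P.Klam` and `1 ≤ L`,
`transferBarRelIdx L klEngGeoTh P (klCT7 …) β U n n Qm k k′ ≤ 2⁷⁶·(KlamU)² + 2³⁶·(Klam|U|)³` at every label — the admissible `r′` of the direct door's rows
`Tb ≤ r′`, `(3/2·m + r′)·Σ|w₁| ≤ 1/3` (a pure U-door entry: with `Σ|w₁| ≤ (3/4)·G.bhi`). -/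
theorem transferBarRelIdx_klCT7_le_uniform {L : ℕ} (hL : 1 ≤ L) {P : SplitConsts} (hKl : 0 ≤ P.Klam) (R : RenConsts) (Q₀ : EngConsts) (G' : GeoConsts)
    (β U : ℝ) (n : ℕ) (Qm k k' : TorusSite 2 L) :
    transferBarRelIdx L klEngGeoTh P (klCT7 P R Q₀ G' klEngGeoTh) β U n n Qm k k' ≤ 2 ^ 76 * (P.Klam * U) ^ 2 + 2 ^ 36 * (P.Klam * |U|) ^ 3 := by
  refine (transferBarRelIdx_klCT7_le_succ_shapes (L := L) hKl R Q₀ G' β U n Qm k k').trans ?_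
  have hρd : 0 ≤ klTorusNorm L (k - k') := by unfold klTorusNorm; exact torusSupNorm_nonneg _
  have hρx : 0 ≤ klTorusNorm L (k + k' - Qm) := by unfold klTorusNorm; exact torusSupNorm_nonneg _
  have hgd := klRelGain_le_uniform (n + 1) hρd
  have hgx := klRelGain_le_uniform (n + 1) hρx
  have h2 : ((2 : ℝ) ^ (n + 1))⁻¹ ≤ 1 / 2 := by
    rw [pow_succ, mul_inv]
    have : ((2 : ℝ) ^ n)⁻¹ ≤ 1 := inv_le_one_of_one_le₀ (one_le_pow₀ (by norm_num))
    nlinarith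
  have h2' : 0 ≤ ((2 : ℝ) ^ (n + 1))⁻¹ := by positivity
  have hL1 : ((L : ℝ))⁻¹ ≤ 1 := inv_le_one_of_one_le₀ (by exact_mod_cast hL)
  have hth := thermalBar_klEngGeoTh_le P U β (n + 1)
  have hU2 : 0 ≤ (P.Klam * U) ^ 2 := by positivity
  have hU3 : 0 ≤ (P.Klam * |U|) ^ 3 := by have := mul_nonneg hKl (abs_nonneg U); positivity
  -- bracket ≤ 24·(KlamU)² + 2^40·(KlamU)² + (Klam|U|)³
  have hbr : (P.Klam * U) ^ 2 * (4 * (klRelGain (n + 1) (klTorusNorm L (k - k')) + ((2 : ℝ) ^ (n + 1))⁻¹) +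
          4 * (klRelGain (n + 1) (klTorusNorm L (k + k' - Qm)) + ((2 : ℝ) ^ (n + 1))⁻¹) + ((L : ℝ))⁻¹) +
        2 * ((P.Klam * |U|) ^ 3 * ((2 : ℝ) ^ (n + 1))⁻¹) + thermalBar klEngGeoTh P U β (n + 1) ≤
      (24 + 2 ^ 40) * (P.Klam * U) ^ 2 + (P.Klam * |U|) ^ 3 := by
    have hA : 4 * (klRelGain (n + 1) (klTorusNorm L (k - k')) + ((2 : ℝ) ^ (n + 1))⁻¹) +
        4 * (klRelGain (n + 1) (klTorusNorm L (k + k' - Qm)) + ((2 : ℝ) ^ (n + 1))⁻¹) + ((L : ℝ))⁻¹ ≤ 24 := by linarith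
    nlinarith [mul_le_mul_of_nonneg_left hA hU2, mul_le_mul_of_nonneg_left h2 hU3]
  calc 2 ^ 21 * 15367 * ((P.Klam * U) ^ 2 * (4 * (klRelGain (n + 1) (klTorusNorm L (k - k')) + ((2 : ℝ) ^ (n + 1))⁻¹) +
          4 * (klRelGain (n + 1) (klTorusNorm L (k + k' - Qm)) + ((2 : ℝ) ^ (n + 1))⁻¹) + ((L : ℝ))⁻¹) +
        2 * ((P.Klam * |U|) ^ 3 * ((2 : ℝ) ^ (n + 1))⁻¹) + thermalBar klEngGeoTh P U β (n + 1))
      ≤ 2 ^ 21 * 15367 * ((24 + 2 ^ 40) * (P.Klam * U) ^ 2 + (P.Klam * |U|) ^ 3) := mul_le_mul_of_nonneg_left hbr (by positivity)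
    _ ≤ 2 ^ 76 * (P.Klam * U) ^ 2 + 2 ^ 36 * (P.Klam * |U|) ^ 3 := by nlinarith [hU2, hU3]

end Summit.HubbardSuperconductivity.HubbardSuperconductivity.Theorems.EngineV8

end
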